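import Summits.Ventures.CertifiedManyBodySolver.Downfold.EmeryBoxesLa214P1ShapeCorners
import Summits.Ventures.CertifiedManyBodySolver.Downfold.EmeryBoxesLa214P2ShapeCorners
import Summits.Ventures.CertifiedManyBodySolver.Downfold.EmeryBoxesLa214P3ShapeCorners
import Summits.Ventures.CertifiedManyBodySolver.Downfold.EmeryBoxesCuprates
import HarnessLib

/-!
# CONVERGENCE OF THE TWO-RAY WINDOW UNDER `t_pp` SPLITTING: the La₂₋ₓSrₓCuO₄ x = 1/8 object-E window from THREE `t_pp` pieces of the typed 3BE box
# (INFL-3to1-B §B.86 (j); router/EMERY-SHAPE-CORNERS.tsv)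

Venture CertifiedManyBodySolver, cell `pub/hubbard-downfold` (stage S1; INFLATION-RULES-3to1-B §B.86 (j)), seat hubbard-downfold-mod-4 (technique B, g35); namespace
`Summit.Ventures.CertifiedManyBodySolver.Downfold.Emery`. Everything PROVED (0 sorry). WHAT THIS IS NOT: a statement about La₂₋ₓSrₓCuO₄ — the typed box `emeryBoxLa214`
(box #18) is SCREENING-GRADE; `U = 0` one-body kinematics of the σ model.

The two-ray rule's only loss on a general box is the virtual-corner inflation of `t_pp′` by the RELATIVE `t_pp` WIDTH `b₂/b₁` of the box (§B.85 (l), §B.86 (f)).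
Splitting the `t_pp` interval into pieces and taking the hull of the piece windows shrinks the factor piecewise (`Icc b₁ b₂ = ⋃ pieces`; each piece is a box to
which `EmeryBoxes<piece>ShapeCorners` applies). For the La₂CuO₄ box at x = 1/8 (ν = 7/16), pieces `t_pp ∈ [0.46, 0.52] ∪ [0.52, 0.59] ∪ [0.59, 0.66]` (factors
1.13, 1.135, 1.12 instead of 1.435):

| device | window for t′/t over the WHOLE box, x = 1/8 | certificates |
|---|---|---|
| two-ray, 1 piece (`EmeryBoxesLa214ShapeCorners`, p788765) | [−0.3091, −0.1590] | 3 + 1 point brackets |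
| **two-ray, 3 t_pp pieces (this file)** | **[−0.2972, −0.1646]** (pieces [−0.2679, −0.1646] · [−0.2836, −0.1779] · [−0.2972, −0.1929]) | 12 point brackets |
| g19 sub-box device of record (router/EMERY-FS-WINDOWS.tsv M15; Δ × t_pd sub-boxes × K = 24 grid) | [−0.2964, −0.1661] | sub-box grid certificates |
| true-corner preview (64² zone grid, screening, NOT certified) | ≈ [−0.2925, −0.1681] | — |

The 3-piece two-ray window is within 0.001 of the sub-box device at the low end and 0.0015 TIGHTER at the high end; the residual gap to the screening preview
(≈ 0.005 / 0.0035) is the per-piece factor ≈ 1.13. READING (value-free): the two devices agree to ±0.002 on the La₂CuO₄ x = 1/8 column — the σ-model one-band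
Fermi-surface shape of EVERY row of box #18 lies in **[−0.297, −0.165]**, vs the object-E row of record [−0.30, −0.20] (float).

Sources: three-band model [HybertsenSchluterChristensen1989, Eq. (1)]; [AndersenEtAl1995, §6]; box rows as cited in `EmeryBoxesCuprates`.
-/

noncomputable section

namespace Summit.Ventures.CertifiedManyBodySolver.Downfold.Emery

open Real Set

/-- **x = 1/8, THREE t_pp PIECES: for every row of the La₂CuO₄ 3BE box the one-band Fermi-surface `t′/t` (object E, at the row's own Fermi energy) lies in
`[−0.2972, −0.1646]`** (hull of the three piece windows). [folklore] -/
theorem la214Box_fsRatio_x0125_split3 {Δ a b c : ℝ} (hΔ : Δ ∈ Icc ((17 : ℝ) / 10) 4) (ha : a ∈ Icc ((129 : ℝ) / 100) ((38 : ℝ) / 25))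
    (hb : b ∈ Icc ((23 : ℝ) / 50) ((33 : ℝ) / 50)) (hc : c ∈ Icc ((3 : ℝ) / 25) ((3 : ℝ) / 20)) :
    fsRatio Δ a b c (fermiEnergyOf Δ a b c ((7 : ℝ) / 16)) ∈ Icc (-((2972 : ℝ) / 10000)) (-((1646 : ℝ) / 10000)) := by
  rcases le_total b ((13 : ℝ) / 25) with h1 | h1
  · have h := la214P1Box_fsRatio_x0125 hΔ ha ⟨hb.1, h1⟩ hc
    exact ⟨by linarith [h.1], by linarith [h.2]⟩
  rcases le_total b ((59 : ℝ) / 100) with h2 | h2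
  · have h := la214P2Box_fsRatio_x0125 hΔ ha ⟨h1, h2⟩ hc
    exact ⟨by linarith [h.1], by linarith [h.2]⟩
  · have h := la214P3Box_fsRatio_x0125 hΔ ha ⟨h2, hb.2⟩ hc
    exact ⟨by linarith [h.1], by linarith [h.2]⟩

/-- **Box form (M15 one-body rows, x = 1/8): for every member `p` of the typed box `emeryBoxLa214` the one-band Fermi-surface `t′/t` of the σ row at filling 7/16
per spin lies in `[−0.2972, −0.1646]`.** [folklore] -/
theorem emeryBoxLa214_fsRatio_x0125_split3 (p : EmeryCoord → ℝ) (hp : emeryBoxLa214.Mem p) :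
    fsRatio (p .DeltaPd) (p .tpd) (p .tpp) (p .tppP) (fermiEnergyOf (p .DeltaPd) (p .tpd) (p .tpp) (p .tppP) ((7 : ℝ) / 16)) ∈
      Icc (-((2972 : ℝ) / 10000)) (-((1646 : ℝ) / 10000)) := by
  have h := (emeryBoxLa214_mem_iff p).1 hp
  push_cast at h
  obtain ⟨h1, h2, h3, h4, h5, h6, h7, h8, -⟩ := h
  exact la214Box_fsRatio_x0125_split3 ⟨by linarith, by linarith⟩ ⟨by linarith, by linarith⟩ ⟨by linarith, by linarith⟩ ⟨by linarith, by linarith⟩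

end Summit.Ventures.CertifiedManyBodySolver.Downfold.Emery
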